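import Literature.NumberTheory.EllipticCurves.ClassPolynomialNegFifteen
import Literature.NumberTheory.EllipticCurves.ComplexMultiplicationClassPolynomialIrreducibleProofs
import Mathlib.FieldTheory.Minpoly.IsIntegrallyClosed
import Mathlib.Analysis.Complex.ExponentialBounds
import HarnessLib

/-!
# The class polynomial of discriminant `−40`: `H_{−40}(X) = X² − 425692800·X + 9103145472000`, and the
# singular moduli `j(√−10) = 212846400 + 95178240√5`, `j(√−10/2) = 212846400 − 95178240√5`

certified instances and evidence bearing on the general Hodge conjecture; no claim.

Topic `NumberTheory/EllipticCurves` (singular moduli); theorem-only file (no definition, no named fact; D-0026), in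
the tree's vocabulary `classPolynomial D = ∏_{Q ∈ reducedForms D} (X − j(τ_Q))`, `formJ Q = j(τ_Q)`, `τ_Q = heegnerTau Q`.

PRINTED. N. Ishii, *Trace of Frobenius endomorphism of an elliptic curve with complex multiplication*, Bull. Austral.
Math. Soc. 70 (2004) = arXiv:math/0401289, §4 "(III) The case `m = 10`, `d(R) = −40`" (held text p. 8, lines 3–4):
"`H₄₀(x) = x² − 425692800x + 9103145472000`, `j(E) = 212846400 + 95178240√5`" (maximal order, class number `2`;
the table of class equations is M. Kaneko's).

METHOD (OURS) — the `2`-isogeny between the two ideal classes, run inside the kernel.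
(1) `reducedForms (−40) = {(1,0,10), (2,0,5)}` (Cox Thm. 2.13; `decide`): `H_{−40} = (X − j₁)(X − j₂)`,
`j₁ = j(τ_{(1,0,10)}) = j(i√10)`, `j₂ = j(τ_{(2,0,5)}) = j(i√10/2)`.  (2) The two classes are `2`-ISOGENOUS:
`τ_{(1,0,10)}/2 = τ_{(4,0,10)} = τ_{(2,0,5)}` (the prime above the ramified `2` is the non-principal class), so `j₂` is a
root of the fibre `Φ₂(x, j₁) = (x − j(2τ₁))(x − j(τ₁/2))(x − j((τ₁+1)/2))` (`ModularPolynomialTwo.eval_kleinJ_eq_prod`,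
Cox (11.14)–(11.15)): `Φ₂(j₂, j₁) = 0` with the tree's explicit `Φ₂` (`intModularPolynomial_two_eval`).  (3) SYMMETRIC
REDUCTION: `Φ₂(x, y) = G(x + y, xy)`, `G(s, p) = −p² + (1485s + 41097375)p + s³ − 162000s² + 8748000000s − 157464·10⁹`,
and on `G = 0`: `(2p − 1485s − 41097375)² = (s + 191025)²(4s + 29025)` (ring identities; `s + 191025` is the
`H_{−15}`-factor of Morton's `Δ₂`, cf. `ClassPolynomialNegFifteen`).  (4) INTEGRALITY: `s = j₁ + j₂`, `p = j₁j₂ ∈ ℤ`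
because `H_{−40}` is the image of `minpoly_ℤ(j₁)` (tree: `minpoly_formJ_map_eq_classPolynomial`, `isIntegral_int_formJ`;
Mathlib: `minpoly.isIntegrallyClosed_eq_field_fractions'`); hence `∃ m ∈ ℤ`: `m² = 4s + 29025`,
`2p = 1485s + 41097375 + (s + 191025)m`.  (5) ONE NUMERIC PIN: the nomes at `τ₁ = i√10`, `τ₂ = i√10/2` are the
positive reals `e^{−2π√10}`, `e^{−π√10} ≤ 10⁻⁴`, so the tree's cusp estimate `|j − 1/q − 744| ≤ 4·10⁵|q|` applies at
BOTH points and `|s − (E² + E + 1488)| ≤ 19.391`, `E = e^{π√10}`; the kernel inequality `20631 ≤ e^{π√10} ≤ 20632.5`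
(`Real.pi_gt_d6`/`pi_lt_d6`, `Real.exp_one_gt_d9`/`lt_d9`, `Real.exp_bound` with ten Taylor terms — no floating
point) gives `41263² < m² < 41267²`, parity gives `|m| = 41265`, so `s = 425692800`; and
`|p| = |j₁||j₂| ≥ (E² + 743.999)(E + 724.61) ≥ 9·10¹²` excludes `m = −41265`, so `p = 9103145472000`.
(6) `(2j₁ − s)² = s² − 4p = 5·190356480²` and `|j₁| > 4·10⁸` select `j₁ = 212846400 + 95178240√5`.

LIMITS. Kernel-checked instance of a printed table row (`H_{−40}` [Ishii2004]); theorem-only; no census number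
changes; nothing about HC.  Not here: `H_{−24}` (its second nome `e^{−π√6} ≈ 4.5·10⁻⁴` exceeds the cusp lemma).
References: [Ishii2004] §4 (III); [Cox2013] Thm. 2.13, §11.B (11.14)–(11.15), Thm. 11.1, Thm. 11.18, §13.A Prop. 13.2;
[GranvilleStark2000] §2 (`|1/q| = e^{π√d/a}`).
-/

noncomputable section

open Complex Polynomial
open UpperHalfPlane hiding I
open scoped Real

namespace Literature.NumberTheory.EllipticCurves

open ModularForms ModularPolynomialTwo
open Literature.NumberTheory.QuadraticFields.BinaryQuadraticForm (reducedForms mem_reducedForms_iff)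

namespace ClassPolynomialNegForty
/-- **Integer points of `G(s, p) = 0`** (`G` = the symmetric reduction of `Φ₂`): if `s + 191025 ≠ 0` then `4s + 29025 = m²`
and `2p = 1485s + 41097375 + (s + 191025)m` for an integer `m`, because `(2p − 1485s − 41097375)² = (s + 191025)²(4s + 29025)`
(ring identity). [cite: Cox2013, §11.C Thm. 11.18 (Φ₂ ∈ ℤ[X,Y] symmetric)] -/
theorem exists_sq_of_G_eq_zero {S P : ℤ}
    (hG : -P ^ 2 + (1485 * S + 41097375) * P + S ^ 3 - 162000 * S ^ 2 + 8748000000 * S - 157464000000000 = 0)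
    (hV : S + 191025 ≠ 0) :
    ∃ m : ℤ, m ^ 2 = 4 * S + 29025 ∧ 2 * P - 1485 * S - 41097375 = (S + 191025) * m := by
  have key : (2 * P - 1485 * S - 41097375) ^ 2 = (S + 191025) ^ 2 * (4 * S + 29025) := by
    linear_combination (-4 : ℤ) * hG
  obtain ⟨m, hm⟩ := (Int.pow_dvd_pow_iff two_ne_zero).mp ⟨_, key⟩
  refine ⟨m, ?_, hm⟩
  have h2 : (S + 191025) ^ 2 * m ^ 2 = (S + 191025) ^ 2 * (4 * S + 29025) := by rw [← key, hm]; ring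
  exact mul_left_cancel₀ (pow_ne_zero 2 hV) h2

/-- **The pin on integers**: `m² = 4S + 29025` and `425660260 ≤ S ≤ 425722197` force `S = 425692800` (`41263² < m² <
41267²`, `m` odd); then `m = ±41265` and `|P| ≥ 9·10¹²` force `P = 9103145472000` (`−` would give `−8470950566625`). [folklore] -/
private theorem eq_of_window {S P m : ℤ} (hm : m ^ 2 = 4 * S + 29025)
    (hPm : 2 * P - 1485 * S - 41097375 = (S + 191025) * m)
    (hlo : 425660260 ≤ S) (hhi : S ≤ 425722197) (hP : 9 * 10 ^ 12 ≤ |P|) :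
    S = 425692800 ∧ P = 9103145472000 := by
  have h1 : |(41263 : ℤ)| < |m| := sq_lt_sq.mp (by nlinarith)
  have h2 : |m| < |(41267 : ℤ)| := sq_lt_sq.mp (by nlinarith)
  rw [abs_of_pos (by norm_num : (0 : ℤ) < 41263)] at h1; rw [abs_of_pos (by norm_num : (0 : ℤ) < 41267)] at h2
  obtain ⟨k, hk⟩ : ∃ k : ℤ, |m| = k := ⟨_, rfl⟩
  have hk2 : k ^ 2 = 4 * S + 29025 := by rw [← hk, sq_abs, hm]
  rw [hk] at h1 h2
  have hS : S = 425692800 := by interval_cases k <;> omega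
  refine ⟨hS, ?_⟩
  subst hS
  have hk5 : k = 41265 := by nlinarith
  rcases (abs_eq (by norm_num : (0 : ℤ) ≤ 41265)).mp (hk.trans hk5) with h | h
  · subst h; omega
  · subst h
    have hP' : P = -8470950566625 := by omega
    rw [hP'] at hP
    norm_num at hP

/-- `τ₁/2 = τ_{(4,0,10)} = τ_{(2,0,5)} = τ₂`: the two classes of discriminant `−40` are `2`-isogenous.
[cite: Cox2013, §11.B (11.14)–(11.15)] -/
theorem divPoint_two_zero_heegnerTau_one_zero_ten : divPoint 2 0 (heegnerTau (1, 0, 10)) = heegnerTau (2, 0, 5) := by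
  have h := divPoint_two_zero_heegnerTau (a := 1) (b := 0) (c := 10) one_pos (by norm_num)
  norm_num at h
  rw [h]
  apply UpperHalfPlane.ext
  rw [coe_heegnerTau_eq (Q := ((4 : ℤ), (0 : ℤ), (10 : ℤ))) (D := 4 * (-40)) (by norm_num) (by norm_num) (by norm_num),
    coe_heegnerTau_eq (Q := ((2 : ℤ), (0 : ℤ), (5 : ℤ))) (D := -40) (by norm_num) (by norm_num) (by norm_num),
    sqrtDisc_four_mul]
  push_cast
  ring

/-- **`Φ₂(j₂, j₁) = 0` in symmetric form: `G(j₁ + j₂, j₁j₂) = 0`** for `j₁ = j(τ_{(1,0,10)})`, `j₂ = j(τ_{(2,0,5)})`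
(`j₂ = j(τ₁/2)` is a root of the fibre of `Φ₂` over `j₁`; `Φ₂(x, y) = G(x + y, xy)` by `ring`). [cite: Cox2013, §11.B (11.14)–(11.15)] -/
theorem G_formJ_eq_zero :
    -(formJ (1, 0, 10) * formJ (2, 0, 5)) ^ 2 +
        (1485 * (formJ (1, 0, 10) + formJ (2, 0, 5)) + 41097375) * (formJ (1, 0, 10) * formJ (2, 0, 5)) +
        (formJ (1, 0, 10) + formJ (2, 0, 5)) ^ 3 - 162000 * (formJ (1, 0, 10) + formJ (2, 0, 5)) ^ 2 +
        8748000000 * (formJ (1, 0, 10) + formJ (2, 0, 5)) - 157464000000000 = 0 := by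
  have h := eval_kleinJ_eq_prod (formJ (2, 0, 5)) (heegnerTau (1, 0, 10))
  rw [intModularPolynomial_two_eval, divPoint_two_zero_heegnerTau_one_zero_ten,
    ← formJ_eq_kleinJ (2, 0, 5), ← formJ_eq_kleinJ (1, 0, 10), sub_self, zero_mul, mul_zero] at h
  linear_combination h

/-- `√(−(−40)) = 2√10` in `ℝ`. [folklore] -/
private theorem sqrt_forty : Real.sqrt (-((-40 : ℤ) : ℝ)) = 2 * √(10 : ℝ) := by
  rw [show (-((-40 : ℤ) : ℝ)) = 2 ^ 2 * 10 by norm_num, Real.sqrt_mul (by norm_num), Real.sqrt_sq (by norm_num)]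

/-- **The nome at `τ₂ = τ_{(2,0,5)} = i√10/2` is the positive real `e^{−π√10}`.**
[cite: GranvilleStark2000, §2 proof of Theorem 1 (`|1/q| = e^{π√d/a}`, here `a = 2`)] -/
theorem qParam_heegnerTau_two_zero_five :
    Function.Periodic.qParam 1 (heegnerTau (2, 0, 5) : ℂ) = (Real.exp (-(π * √(10 : ℝ))) : ℂ) := by
  rw [qParam_one_eq_cexp, Complex.ofReal_exp,
    coe_heegnerTau_eq (Q := ((2 : ℤ), (0 : ℤ), (5 : ℤ))) (D := -40) (by norm_num) (by norm_num) (by norm_num),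
    sqrtDisc, sqrt_forty]
  congr 1
  push_cast
  linear_combination (π * (√(10 : ℝ) : ℂ)) * Complex.I_mul_I

/-- **The nome at `τ₁ = τ_{(1,0,10)} = i√10` is the positive real `e^{−2π√10} = (e^{−π√10})²`.**
[cite: GranvilleStark2000, §2 proof of Theorem 1 (`|1/q| = e^{π√d}`)] -/
theorem qParam_heegnerTau_one_zero_ten :
    Function.Periodic.qParam 1 (heegnerTau (1, 0, 10) : ℂ) = (Real.exp (-(π * √(10 : ℝ))) ^ 2 : ℂ) := by
  rw [qParam_one_eq_cexp, ← Complex.ofReal_pow, ← Real.exp_nat_mul, Complex.ofReal_exp,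
    coe_heegnerTau_eq (Q := ((1 : ℤ), (0 : ℤ), (10 : ℤ))) (D := -40) (by norm_num) (by norm_num) (by norm_num),
    sqrtDisc, sqrt_forty]
  congr 1
  push_cast
  linear_combination (2 * π * (√(10 : ℝ) : ℂ)) * Complex.I_mul_I

/-- **The numeric pin: `20631 ≤ e^{π√10} ≤ 20632.5`** (true value `20631.7878…`) — a kernel inequality from Mathlib's
certified bounds only: `Real.pi_gt_d6`/`pi_lt_d6` and `3.16227766 < √10 < 3.16227767` give `9.93458 ≤ π√10 ≤ 9.93459`;
`e^{9.9345x} = (e¹)⁹·e^{0.9345x}` with `Real.exp_one_gt_d9`/`lt_d9` and ten Taylor terms (`Real.exp_bound`). [folklore] -/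
private theorem exp_pi_sqrt_ten_bounds : (20631 : ℝ) ≤ Real.exp (π * √(10 : ℝ)) ∧ Real.exp (π * √(10 : ℝ)) ≤ 20632.5 := by
  have hs1 : (3.16227766 : ℝ) < √(10 : ℝ) := (Real.lt_sqrt (by norm_num)).mpr (by norm_num)
  have hs2 : √(10 : ℝ) < 3.16227767 := (Real.sqrt_lt' (by norm_num)).mpr (by norm_num)
  have hπ1 : (3.141592 : ℝ) < π := Real.pi_gt_d6
  have hπ2 : π < 3.141593 := Real.pi_lt_d6
  have hx1 : (9.93458 : ℝ) ≤ π * √(10 : ℝ) := by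
    nlinarith [mul_nonneg (sub_nonneg.mpr hπ1.le) (sub_nonneg.mpr hs1.le)]
  have hx2 : π * √(10 : ℝ) ≤ 9.93459 := by
    nlinarith [mul_nonneg (sub_nonneg.mpr hπ2.le) (sub_nonneg.mpr hs2.le)]
  have he1 : (2.7182818283 : ℝ) < Real.exp 1 := Real.exp_one_gt_d9
  have he2 : Real.exp 1 < (2.7182818286 : ℝ) := Real.exp_one_lt_d9
  have h9pos := pow_pos (Real.exp_pos (1 : ℝ)) 9
  constructor
  · refine le_trans ?_ (Real.exp_le_exp.mpr hx1)
    have hsplit : Real.exp (9.93458 : ℝ) = Real.exp 1 ^ 9 * Real.exp (0.93458 : ℝ) := by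
      rw [← Real.exp_nat_mul, ← Real.exp_add]; norm_num
    have hy : |(0.93458 : ℝ)| ≤ 1 := by rw [abs_of_pos (by norm_num)]; norm_num
    have hT := Real.exp_bound hy (n := 10) (by norm_num)
    simp only [Finset.sum_range_succ, Finset.sum_range_zero, Nat.factorial, Nat.succ_eq_add_one] at hT
    norm_num at hT
    have hlow := (abs_sub_le_iff.1 hT).2
    have h9 : (2.7182818283 : ℝ) ^ 9 ≤ Real.exp 1 ^ 9 := pow_le_pow_left₀ (by norm_num) he1.le 9
    rw [hsplit]
    nlinarith [Real.exp_pos (0.93458 : ℝ)]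
  · refine le_trans (Real.exp_le_exp.mpr hx2) ?_
    have hsplit : Real.exp (9.93459 : ℝ) = Real.exp 1 ^ 9 * Real.exp (0.93459 : ℝ) := by
      rw [← Real.exp_nat_mul, ← Real.exp_add]; norm_num
    have hy : |(0.93459 : ℝ)| ≤ 1 := by rw [abs_of_pos (by norm_num)]; norm_num
    have hT := Real.exp_bound hy (n := 10) (by norm_num)
    simp only [Finset.sum_range_succ, Finset.sum_range_zero, Nat.factorial, Nat.succ_eq_add_one] at hT
    norm_num at hT
    have hup := (abs_sub_le_iff.1 hT).1
    have h9 : Real.exp 1 ^ 9 ≤ (2.7182818286 : ℝ) ^ 9 := pow_le_pow_left₀ (Real.exp_pos _).le he2.le 9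
    rw [hsplit]
    nlinarith [Real.exp_pos (0.93459 : ℝ)]

/-- **`|j(i√10/2) − e^{π√10} − 744| ≤ 4·10⁵·e^{−π√10}`**: the tree's first-order cusp estimate at `τ₂ = i√10/2`
(`q = e^{−π√10} ≤ 10⁻⁴`). [cite: GranvilleStark2000, §2 proof of Theorem 1] -/
theorem norm_formJ_two_zero_five_sub_le :
    ‖formJ (2, 0, 5) - (Real.exp (π * √(10 : ℝ)) : ℂ) - 744‖ ≤ 400000 * Real.exp (-(π * √(10 : ℝ))) := by
  have hq := qParam_heegnerTau_two_zero_five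
  have hqn : ‖Function.Periodic.qParam 1 (heegnerTau (2, 0, 5) : ℂ)‖ = Real.exp (-(π * √(10 : ℝ))) := by
    rw [hq, Complex.norm_real, Real.norm_eq_abs, abs_of_pos (Real.exp_pos _)]
  have hq4 : ‖Function.Periodic.qParam 1 (heegnerTau (2, 0, 5) : ℂ)‖ ≤ 1 / 10 ^ 4 := by
    rw [hqn, Real.exp_neg, inv_le_comm₀ (Real.exp_pos _) (by norm_num)]
    have : (1 / (10 : ℝ) ^ 4)⁻¹ = 10 ^ 4 := by norm_num
    rw [this]; linarith [exp_pi_sqrt_ten_bounds.1]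
  have hj : formJ (2, 0, 5) = ModularForm.E₄ (heegnerTau (2, 0, 5)) ^ 3 / ModularForm.discriminant (heegnerTau (2, 0, 5)) := by
    rw [formJ_eq_kleinJ]; rfl
  have hcusp := norm_E₄_cube_div_discriminant_sub_sub_le (heegnerTau (2, 0, 5)) hq4
  rw [← hj, hqn, hq, ← Complex.ofReal_inv, Real.exp_neg, inv_inv] at hcusp
  rw [Real.exp_neg]; exact hcusp

/-- **`|j(i√10) − e^{2π√10} − 744| ≤ 4·10⁵·e^{−2π√10}`**: the cusp estimate at `τ₁ = i√10` (`q = e^{−2π√10}`).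
[cite: GranvilleStark2000, §2 proof of Theorem 1] -/
theorem norm_formJ_one_zero_ten_sub_le :
    ‖formJ (1, 0, 10) - (Real.exp (π * √(10 : ℝ)) : ℂ) ^ 2 - 744‖ ≤ 400000 * Real.exp (-(π * √(10 : ℝ))) ^ 2 := by
  have hq := qParam_heegnerTau_one_zero_ten
  have hqn : ‖Function.Periodic.qParam 1 (heegnerTau (1, 0, 10) : ℂ)‖ = Real.exp (-(π * √(10 : ℝ))) ^ 2 := by
    rw [hq, ← Complex.ofReal_pow, Complex.norm_real, Real.norm_eq_abs, abs_of_pos (pow_pos (Real.exp_pos _) 2)]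
  have hE := exp_pi_sqrt_ten_bounds.1
  have hq4 : ‖Function.Periodic.qParam 1 (heegnerTau (1, 0, 10) : ℂ)‖ ≤ 1 / 10 ^ 4 := by
    rw [hqn, Real.exp_neg, inv_pow, inv_le_comm₀ (pow_pos (Real.exp_pos _) 2) (by norm_num)]
    have : (1 / (10 : ℝ) ^ 4)⁻¹ = 10 ^ 4 := by norm_num
    rw [this]; nlinarith [Real.exp_pos (π * √(10 : ℝ))]
  have hj : formJ (1, 0, 10) = ModularForm.E₄ (heegnerTau (1, 0, 10)) ^ 3 / ModularForm.discriminant (heegnerTau (1, 0, 10)) := by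
    rw [formJ_eq_kleinJ]; rfl
  have hcusp := norm_E₄_cube_div_discriminant_sub_sub_le (heegnerTau (1, 0, 10)) hq4
  rw [← hj, hqn, hq, ← Complex.ofReal_pow, ← Complex.ofReal_inv, ← inv_pow, Real.exp_neg, inv_inv,
    Complex.ofReal_pow] at hcusp
  rw [Real.exp_neg]; exact hcusp

/-- **`|j(i√10)| ≥ e^{2π√10} + 743.999`** (from the window at `τ₁` and `E ≥ 20631`). [cite: GranvilleStark2000, §2 proof of Theorem 1] -/
theorem le_norm_formJ_one_zero_ten : Real.exp (π * √(10 : ℝ)) ^ 2 + 743.999 ≤ ‖formJ (1, 0, 10)‖ := by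
  have hw := norm_formJ_one_zero_ten_sub_le
  obtain ⟨hE1, -⟩ := exp_pi_sqrt_ten_bounds
  rw [Real.exp_neg] at hw
  set E := Real.exp (π * √(10 : ℝ))
  have hb : 400000 * E⁻¹ ^ 2 ≤ 1 / 1000 := by
    rw [inv_pow, ← div_eq_mul_inv, div_le_iff₀ (by positivity)]; nlinarith
  have htri : ‖(E : ℂ) ^ 2 + 744‖ ≤ ‖formJ (1, 0, 10)‖ + ‖formJ (1, 0, 10) - (E : ℂ) ^ 2 - 744‖ := by
    have e : (E : ℂ) ^ 2 + 744 = formJ (1, 0, 10) - (formJ (1, 0, 10) - (E : ℂ) ^ 2 - 744) := by ring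
    rw [e]; exact norm_sub_le _ _
  have hval : ‖(E : ℂ) ^ 2 + 744‖ = E ^ 2 + 744 := by
    rw [show (E : ℂ) ^ 2 + 744 = ((E ^ 2 + 744 : ℝ) : ℂ) by push_cast; ring, Complex.norm_real, Real.norm_eq_abs, abs_of_pos (by positivity)]
  linarith

/-- **`|j(i√10/2)| ≥ e^{π√10} + 724.61`** (from the window at `τ₂` and `E ≥ 20631`). [cite: GranvilleStark2000, §2 proof of Theorem 1] -/
theorem le_norm_formJ_two_zero_five : Real.exp (π * √(10 : ℝ)) + 724.61 ≤ ‖formJ (2, 0, 5)‖ := by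
  have hw := norm_formJ_two_zero_five_sub_le
  obtain ⟨hE1, -⟩ := exp_pi_sqrt_ten_bounds
  rw [Real.exp_neg] at hw
  set E := Real.exp (π * √(10 : ℝ))
  have hb : 400000 * E⁻¹ ≤ 19.39 := by rw [← div_eq_mul_inv, div_le_iff₀ (Real.exp_pos _)]; nlinarith
  have htri : ‖(E : ℂ) + 744‖ ≤ ‖formJ (2, 0, 5)‖ + ‖formJ (2, 0, 5) - (E : ℂ) - 744‖ := by
    have e : (E : ℂ) + 744 = formJ (2, 0, 5) - (formJ (2, 0, 5) - (E : ℂ) - 744) := by ring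
    rw [e]; exact norm_sub_le _ _
  have hval : ‖(E : ℂ) + 744‖ = E + 744 := by
    rw [show (E : ℂ) + 744 = ((E + 744 : ℝ) : ℂ) by push_cast; ring, Complex.norm_real, Real.norm_eq_abs, abs_of_pos (by positivity)]
  linarith

/-- `reducedForms (−40) = {(1,0,10), (2,0,5)}` (`h(−40) = 2`). [cite: Cox2013, Thm. 2.13] -/
theorem reducedForms_neg_forty : reducedForms (-40) = {((1 : ℤ), (0 : ℤ), (10 : ℤ)), (2, 0, 5)} := by
  decide

/-- **`H_{−40}` is the image in `ℂ[X]` of `minpoly_ℤ(j(i√10))`** (the class polynomial has integer coefficients: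
Cox Prop. 13.2 with Thm. 11.1 (i), and `ℤ` integrally closed). [cite: Cox2013, §13.A Prop. 13.2 (with Thm. 11.1 (i))] -/
theorem classPolynomial_neg_forty_eq_map_minpoly_int :
    classPolynomial (-40) = (minpoly ℤ (formJ (1, 0, 10))).map (algebraMap ℤ ℂ) := by
  have hQ : ((1 : ℤ), (0 : ℤ), (10 : ℤ)) ∈ reducedForms (-40) := by rw [reducedForms_neg_forty]; simp
  have hD : (-40 : ℤ) < 0 := by norm_num
  obtain ⟨hdQ, hQ1, hQprim, -⟩ := (mem_reducedForms_iff hD).1 hQ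
  have hint : IsIntegral ℤ (formJ (1, 0, 10)) := isIntegral_int_formJ hQ1 hQprim (by rw [hdQ]; exact hD)
  rw [← minpoly_formJ_map_eq_classPolynomial hD hQ, minpoly.isIntegrallyClosed_eq_field_fractions' ℚ hint,
    Polynomial.map_map]
  congr 1

/-- **`j₁ + j₂ ∈ ℤ` and `j₁j₂ ∈ ℤ`**: the coefficients of `H_{−40} = (X − j₁)(X − j₂) ∈ ℤ[X]`. [cite: Cox2013, §13.A Prop. 13.2 (with Thm. 11.1 (i))] -/
theorem exists_int_trace_norm :
    ∃ S P : ℤ, formJ (1, 0, 10) + formJ (2, 0, 5) = S ∧ formJ (1, 0, 10) * formJ (2, 0, 5) = P := by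
  set M := minpoly ℤ (formJ (1, 0, 10)) with hM
  have h := classPolynomial_neg_forty_eq_map_minpoly_int
  rw [classPolynomial, reducedForms_neg_forty, Finset.prod_pair (by decide)] at h
  have hprod : (X - C (formJ (1, 0, 10))) * (X - C (formJ (2, 0, 5))) =
      X ^ 2 - C (formJ (1, 0, 10) + formJ (2, 0, 5)) * X + C (formJ (1, 0, 10) * formJ (2, 0, 5)) := by
    rw [C_add, C_mul]; ring
  rw [hprod] at h
  have h1 := congr_arg (fun p : ℂ[X] => p.coeff 1) h
  have h0 := congr_arg (fun p : ℂ[X] => p.coeff 0) h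
  simp only [coeff_add, coeff_sub, coeff_X_pow, coeff_C_mul, coeff_X, coeff_C, coeff_map, eq_intCast] at h1 h0
  norm_num at h1 h0
  refine ⟨-(M.coeff 1), M.coeff 0, ?_, ?_⟩
  · push_cast; linear_combination -h1
  · exact_mod_cast h0

/-- **Trace and norm: `j₁ + j₂ = 425692800`, `j₁j₂ = 9103145472000`** — the coefficients of the printed
`H₄₀(x) = x² − 425692800x + 9103145472000`, derived in the kernel by steps 2–5 of the module docstring.
[cite: Ishii2004, §4 (III) (`H₄₀(x)`, held text p. 8 lines 3–4)] -/
theorem formJ_add_and_mul :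
    formJ (1, 0, 10) + formJ (2, 0, 5) = 425692800 ∧ formJ (1, 0, 10) * formJ (2, 0, 5) = 9103145472000 := by
  obtain ⟨S, P, hS, hP⟩ := exists_int_trace_norm
  have hw1 := norm_formJ_one_zero_ten_sub_le
  have hw2 := norm_formJ_two_zero_five_sub_le
  have hn1 := le_norm_formJ_one_zero_ten
  have hn2 := le_norm_formJ_two_zero_five
  obtain ⟨hE1, hE2⟩ := exp_pi_sqrt_ten_bounds
  rw [Real.exp_neg] at hw1 hw2
  set E := Real.exp (π * √(10 : ℝ)) with hEdef
  have hEpos : 0 < E := Real.exp_pos _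
  have hb1 : 400000 * E⁻¹ ^ 2 ≤ 1 / 1000 := by
    rw [inv_pow, ← div_eq_mul_inv, div_le_iff₀ (by positivity)]; nlinarith
  have hb2 : 400000 * E⁻¹ ≤ 19.39 := by rw [← div_eq_mul_inv, div_le_iff₀ hEpos]; nlinarith
  have htr : ‖((S : ℂ)) - ((E ^ 2 + E + 1488 : ℝ) : ℂ)‖ ≤ 19.391 := by
    have e : (S : ℂ) - ((E ^ 2 + E + 1488 : ℝ) : ℂ) =
        (formJ (1, 0, 10) - (E : ℂ) ^ 2 - 744) + (formJ (2, 0, 5) - (E : ℂ) - 744) := by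
      rw [← hS]; push_cast; ring
    rw [e]
    exact (norm_add_le _ _).trans (by linarith)
  have e : ((S : ℂ)) - ((E ^ 2 + E + 1488 : ℝ) : ℂ) = (((S : ℝ) - (E ^ 2 + E + 1488) : ℝ) : ℂ) := by
    push_cast; ring
  rw [e, Complex.norm_real, Real.norm_eq_abs] at htr
  obtain ⟨hlo', hhi'⟩ := abs_le.mp htr
  have hlo : (425660260 : ℤ) ≤ S := by exact_mod_cast (by nlinarith : (425660260 : ℝ) ≤ S)
  have hhi : S ≤ (425722197 : ℤ) := by exact_mod_cast (by nlinarith : (S : ℝ) ≤ 425722197)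
  have hPabs : (9 * 10 ^ 12 : ℤ) ≤ |P| := by
    have h : (9 * 10 ^ 12 : ℝ) ≤ ‖(P : ℂ)‖ := by
      rw [← hP, norm_mul]
      calc (9 * 10 ^ 12 : ℝ) ≤ (E ^ 2 + 743.999) * (E + 724.61) := by nlinarith
        _ ≤ ‖formJ (1, 0, 10)‖ * ‖formJ (2, 0, 5)‖ := mul_le_mul hn1 hn2 (by positivity) (norm_nonneg _)
    rw [Complex.norm_intCast] at h
    exact_mod_cast h
  have hG : -P ^ 2 + (1485 * S + 41097375) * P + S ^ 3 - 162000 * S ^ 2 + 8748000000 * S - 157464000000000 = 0 := by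
    have h := G_formJ_eq_zero
    rw [hS, hP] at h
    exact_mod_cast h
  obtain ⟨m, hm, hPm⟩ := exists_sq_of_G_eq_zero hG (by omega)
  obtain ⟨rfl, rfl⟩ := eq_of_window hm hPm hlo hhi hPabs
  exact ⟨by exact_mod_cast hS, by exact_mod_cast hP⟩

/-- `(√5)² = 5` in `ℂ`. [folklore] -/
private theorem sqrt_five_sq : ((√(5 : ℝ) : ℝ) : ℂ) ^ 2 = 5 := by
  rw [← Complex.ofReal_pow, Real.sq_sqrt (by norm_num)]; norm_num

/-- **`j(i√10) = 212846400 + 95178240√5`** (Ishii's `j(E)` for `d(R) = −40`): the root of `H_{−40}` of modulus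
`> 4·10⁸`; the conjugate root is `< 22000`. [cite: Ishii2004, §4 (III) (`j(E) = 212846400 + 95178240√5`)] -/
theorem formJ_one_zero_ten_eq : formJ (1, 0, 10) = 212846400 + 95178240 * (√(5 : ℝ) : ℂ) := by
  obtain ⟨hs, hp⟩ := formJ_add_and_mul
  have hsq : (2 * formJ (1, 0, 10) - 425692800) ^ 2 = (190356480 * (√(5 : ℝ) : ℂ)) ^ 2 := by
    have hj2 : formJ (2, 0, 5) = 425692800 - formJ (1, 0, 10) := by linear_combination hs
    rw [hj2] at hp
    linear_combination (-4 : ℂ) * hp - 190356480 ^ 2 * sqrt_five_sq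
  rcases sq_eq_sq_iff_eq_or_eq_neg.mp hsq with h | h
  · linear_combination (1 / 2 : ℂ) * h
  · exfalso
    have hj : formJ (1, 0, 10) = ((212846400 - 95178240 * √(5 : ℝ) : ℝ) : ℂ) := by
      push_cast; linear_combination (1 / 2 : ℂ) * h
    have hn : (4 * 10 ^ 8 : ℝ) ≤ ‖formJ (1, 0, 10)‖ := by
      have h1 := le_norm_formJ_one_zero_ten
      nlinarith [exp_pi_sqrt_ten_bounds.1, Real.exp_pos (π * √(10 : ℝ))]
    rw [hj, Complex.norm_real, Real.norm_eq_abs] at hn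
    have hs1 : (2.236 : ℝ) < √(5 : ℝ) := (Real.lt_sqrt (by norm_num)).mpr (by norm_num)
    have hs2 : √(5 : ℝ) < 2.237 := (Real.sqrt_lt' (by norm_num)).mpr (by norm_num)
    have hlt : |(212846400 - 95178240 * √(5 : ℝ) : ℝ)| < 4 * 10 ^ 8 := by rw [abs_lt]; constructor <;> linarith
    linarith

/-- **`j(i√10/2) = j(τ_{(2,0,5)}) = 212846400 − 95178240√5`** (the conjugate root). [cite: Ishii2004, §4 (III)] -/
theorem formJ_two_zero_five_eq : formJ (2, 0, 5) = 212846400 - 95178240 * (√(5 : ℝ) : ℂ) := by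
  linear_combination formJ_add_and_mul.1 - formJ_one_zero_ten_eq

end ClassPolynomialNegForty

open ClassPolynomialNegForty

/-- **`H_{−40}(X) = X² − 425692800·X + 9103145472000`**: the class polynomial of discriminant `−40` (`h(−40) = 2`,
reduced forms `(1,0,10)`, `(2,0,5)`), as a kernel theorem about the tree's
`classPolynomial (−40) = (X − j(τ_{(1,0,10)}))(X − j(τ_{(2,0,5)}))`.
[cite: Ishii2004, §4 (III) (`H₄₀(x) = x² − 425692800x + 9103145472000`, held text p. 8 lines 3–4)] -/
theorem classPolynomial_neg_forty : classPolynomial (-40) = X ^ 2 - C (425692800 : ℂ) * X + C (9103145472000 : ℂ) := by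
  rw [classPolynomial, reducedForms_neg_forty, Finset.prod_pair (by decide)]
  obtain ⟨hs, hp⟩ := formJ_add_and_mul
  calc (X - C (formJ (1, 0, 10))) * (X - C (formJ (2, 0, 5)))
      = X ^ 2 - C (formJ (1, 0, 10) + formJ (2, 0, 5)) * X + C (formJ (1, 0, 10) * formJ (2, 0, 5)) := by
        rw [C_add, C_mul]; ring
    _ = X ^ 2 - C (425692800 : ℂ) * X + C (9103145472000 : ℂ) := by rw [hs, hp]

/-- `H_{−40}(x) = x² − 425692800x + 9103145472000` for every `x ∈ ℂ`. [cite: Ishii2004, §4 (III)] -/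
theorem classPolynomial_neg_forty_eval (x : ℂ) :
    (classPolynomial (-40)).eval x = x ^ 2 - 425692800 * x + 9103145472000 := by
  rw [classPolynomial_neg_forty]
  simp only [eval_add, eval_sub, eval_mul, eval_pow, eval_X, eval_C]

/-- **`H_{−40}(0) = 9103145472000 = 20880³`** (the norm of `j(i√10)` is a cube; `20880 = 2⁴·3²·5·29`).
[cite: Ishii2004, §4 (III)] -/
theorem classPolynomial_neg_forty_eval_zero : (classPolynomial (-40)).eval 0 = 20880 ^ 3 := by
  rw [classPolynomial_neg_forty_eval]; norm_num

/-- **`H_{−40}(1728) = 8367551299584 = 2892672² = 2¹⁴·3¹²·31²`** (the norm of `j(i√10) − 1728` is a square).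
[cite: Ishii2004, §4 (III)] -/
theorem classPolynomial_neg_forty_eval_1728 : (classPolynomial (-40)).eval 1728 = 2892672 ^ 2 := by
  rw [classPolynomial_neg_forty_eval]; norm_num

/-- **`j(𝒪_K) = 212846400 + 95178240√5` for `K = ℚ(√−10)`**: the `j`-invariant of `𝒪_K = ℤ[√−10]` (the tree's
`cmPeriodPair (−40)`), via `formJ_principalForm`. [cite: Ishii2004, §4 (III) (`j(E)`)] -/
theorem j_cmPeriodPair_neg_forty : (cmPeriodPair (-40)).j = 212846400 + 95178240 * (√(5 : ℝ) : ℂ) := by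
  have hP : Literature.NumberTheory.QuadraticFields.BinaryQuadraticForm.principalForm (-40) =
      ((1 : ℤ), (0 : ℤ), (10 : ℤ)) := by decide
  rw [← formJ_principalForm (D := -40) (by norm_num) (by norm_num), hP, formJ_one_zero_ten_eq]

end Literature.NumberTheory.EllipticCurves

end
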